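import Summits.QuantumFields.YangMills.Theorems.UnitScaleTiltProp7HessRowOfEq111T3
import Summits.QuantumFields.YangMills.Theorems.UnitScaleTiltProp7SPrintDefsS
import Summits.QuantumFields.YangMills.Theorems.UnitScaleTiltProp7SectET3DeltaOneT3Rows
import Literature.MathematicalPhysics.QuantumFieldTheory.Balaban1983to89.B9Eq3119DeltaPiCarrier
import Literature.MathematicalPhysics.QuantumFieldTheory.Balaban1983to89.B11Eq98CurrentSlot
import HarnessLib

/-!
# Route `UnitScaleTilt`, crux «MinimiserStabilityRegPr» (stmt-QuantumFields-19200, stub EX `stub_existenceMinimalOrbit`, route (α)) — «CRIT93-OF-84»: THE FIRST-ORDER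
# SIBLING OF E2-133 — print's (93) FOR THE SOLUTION OF (111) FROM (111) + THE (84) JUNCTION ROW, the Sect. C algebra (99)→(111) of [Balaban1985Variational] READ BACKWARDS
# at the T³ member, SLOT-GENERIC (`Δx`), with the `Δ_π` specialisation

Cell `ym3-torus` (HUMAN RULING D-0037, YM ladder rung R3 — YM₃ on T³, NOT d = 4, NOT Clay; YM gap NOT proved), width seat `ym3-torus-px21` gen 2 (explicit-unit helper;
lineage: ✓`Prop7Crit127OfCrit93Split` (the (123)–(127) door), ✓`Prop7Crit127Split127AtZero`).  THEOREMS ONLY (0 `def`, 0 `sorry`); `--supports stmt-QuantumFields-19200 --as helper`,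
count-neutral; NO claim on crux ∕ stub ∕ registry.

THE PRINT.  [Balaban1985Variational] p. 290 (82)–(84): «To find critical points of this functional we have to find A′ … such that ⟨(δ∕δA′)𝔉(A′), δA′⟩ = 0 (82) holds for all δA′ in the
tangent space, that is δA′ satisfying QδA′ = 0, RD*δA′ = 0 (83) … From (81) we have ⟨(δ∕δA′)𝔉(A′), δA′⟩ = ⟨δA′, J⟩ + ⟨δA′, Δ₁A′⟩ + ⟨(δ∕δA′)V(A′), δA′⟩ (84)»; p. 291 (93) = (82) on (83);
p. 293 (99) «⟨δA′, J⟩ + ⟨δA′, Δ₁A′⟩ + ⟨δA′, (δ∕δA′)V(A′)⟩ = 0», (102)–(103) `A′ = A₁ + H₁B`, `QA₁ = 0`, `RD*A₁ = 0`; p. 294 (110)–(111) «We denote by G₁ an inverse operator to the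
operator Δ₁ + DRD* + aQ*Q … A₁ + 𝔊J + 𝔊((δ∕δA′)V)(A₁ + H₁B) = 0 (111) … the operator G₁𝔓* is equal to the operator 𝔊».  [Balaban1985BackgroundPropagators] (3.26) p. 395
`Δ_a = Δ + DRD* + Q*aQ`, (3.126) `H = GQ*(QGQ*)⁻¹`, (3.147) `𝔓 = I − GQ*(QGQ*)⁻¹Q − GDRD*`, (3.153) `𝔊 = G𝔓*`, (3.21) `R` an orthogonal projection, (3.8) `D*` the adjoint of `D`.

WHY (located, this seat's sign-in 2026-08-28T19:4xZ).  Print DERIVES (111) from (93) through (99)–(110); every step is an identity of linear maps except the calculus identity (84).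
So the EX display's row `hCrit93′` (ray-criticality of `𝒜` along the slice at the (111)-solution) descends to ONE displayed row — (84) at the member, «the chart ray HAS DERIVATIVE
`re(κ·⟪toL2 δ, Ĵ + Ŵ + Δx(toL2 A′♭)⟫)`» — plus pure Hilbert-space algebra over the landed layer-0 letters: for `Y = −𝔊x + Hb` (E2-133's reading ✓`toL2_iota_eq111` of (111)) and every `δ̂`
on the slice (`Q_kδ̂ = 0`, `R_S(D*δ̂) = 0`), `⟪x + Δx Y, δ̂⟫ = 0`: by ✓`Prop7HessRowOfEq111.slot_sol_eq` the vector `x + Δx Y` is `Q_k†(…) + D(R_S(D*(Gx))) + Q_k†(…) − Q_k†(…)`; the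
`range Q_k†` terms die on `ker Q_k` (`⟪Q_k†z, δ̂⟫ = ⟪z, Q_kδ̂⟫`) and the LANDAU MULTIPLIER `DR_SD*Gx` dies on the Landau slice (`D* = D†` ✓`adjoint_DL2`, `R_S = R_S†` ✓`RS_isSymmetric`).
SLOT REMARK (LOCATE `ym3-torus-px21/LOCATE-CRIT93-SLOT-px21g2.md`): the theorems below hold at ANY slot `Δx` with E2-133's two Landau guards; the displayed (84)-row is print's (84) —
i.e. inhabited by the intended `Wf := (δ∕δA′)V` with `prop4` (quadratic) — exactly when `Δx` is the Hessian of the chart functional, print's `Δ₁ = Δ_π − Δ_π⁽²⁾` ((79); tree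
✓`Prop7SectET3DeltaOne.DeltaOneJ`), not `Δ_π`.

WHAT IS PROVED (member `F`, `h : n ≤ K`, weights `c₀ cB a`, slot `Δx`, background `U₀`):
* §1 ★★`inner_firstOrder_sol_eq_zero` (generic slot, on `PosOnto` + the two Landau guards `hΔ hΔ′` of ✓`slot_sol_eq`), `inner_firstOrder_sol_eq_zero_pi` (slot `Δ_π`: the guards from
  `PosPrime`, ✓`DeltaPiSlot_kills_NS` ∕ ✓`inner_DL2_DeltaPi_eq_zero`); the slice dictionary `Qk_toL2_eq_zero_of_QTwS` (`QTwS U₀ δ = 0 ⟹ Q_k(toL2 δ) = 0`), `RS_DstarL2_toL2_eq_zero_of_landau`.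
* §2 `deriv_eq_zero_of_hasDerivAt_re_inner` (calculus shell: `⟪v, δ̂⟫ = 0` and `HasDerivAt f (re(κ·⟪δ̂, v⟫)) 0` ⟹ `deriv f 0 = 0`); ★★★`deriv_eq_zero_of_eq111_of_h84` — IN THE EX KNIT'S
  LETTERS at the member (generic slot): from the knit's (111) text `A₁ + 𝒢f J + 𝒢f W = 0` (`𝒢f := frakGfR … Δx U₀`), the datum `B̃`, a slice direction `δ` (`QTwS U₀ δ = 0`,
  `IsLandauPrintS c₀ cB U₀ δ`) and the displayed (84)-row for ANY real function `f` (the knit instantiates `f :=` the chart ray of `hCrit93′`) conclude `deriv f 0 = 0`;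
  ★★★`deriv_eq_zero_of_eq111_of_h84_pi` — the same at the slot of record `Δ_π` from S9's class row `PosOnto … (DeltaPiSlot …) U₀ ∧ PosPrime … U₀`;
  ★★★`deriv_eq_zero_of_eq111_of_h84_one` — the same at PRINT'S slot `Δ₁ = Pᵀ(Δ^η + T_J)P` (✓`Prop7SectET3DeltaOne.DeltaOne … TJ`, any `T_J`; `DeltaOneJ` is `TJ := TJSlot`) from
  `PosOnto … (DeltaOne … TJ) U₀ ∧ PosPrime … U₀` (guards ✓`DeltaOne_kills_NS` ∕ ✓`inner_DL2_DeltaOne_eq_zero`) — the slot at which the (84)-row is print's (84).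
* §3 (27)-PAIRING CURRENCY (the conclusion shape of lit `B11Eq81ExpansionZpow.hasDerivAt_actionZ_chartRay_real`, ym3-torus-px19): `funEquiv_symm_eq_toL2'`, ★`pair27_eq_inner_toL2`
  (`pair27 τ₂ K g = η³c₀⁻¹⟪toL2 (g♭)ᴴ, toL2 K♭⟫`), ★`toL2_currentCLM` (`toL2 ((currentCLM … T Y)♭) = T (toL2 ιY)`), ★★`sum_pair27_eq_inner` (the three pairings of (84) = `η³c₀⁻¹⟪toL2 (ιδ′)ᴴ,
  (Ĵ + Ŵ) + T(toL2 ιA′)⟫`), ★★★`deriv_eq_zero_of_eq111_of_h84_pair27` — the door with `h84 : HasDerivAt f (re(κ·(⟨δ′,J⟩ + ⟨δ′, Δ̂ₓ A′⟩ + ⟨δ′, W⟩))) 0`, `Δ̂ₓ := currentCLM … (Δx U₀)`,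
  `A′ := A₁ + H₁f B̃`, Hermitian `ιδ′` on the slice.
INHABITABILITY (★★OWNER RULING g27-№9 (3)) of the one new displayed row `h84` (stated by the consumer with `f :=` the ray): print's (84) with `κ := ±i·η²∕(2c₀)`-type normalisation
([Balaban1985Variational] (26)–(27), (81), (84); T³: ✓`Prop7Crit127OfCrit93Split.hasDerivAt_wilsonAction4_chartRay` gives the ray's derivative as `Lin_{U′}(vel δ)`), FOR THE SLOT
`Δx := Δ₁` and `W := (δ∕δA′)V`; at `Δx := Δ_π` see the SLOT REMARK (not inhabitable together with a quadratic `prop4` off critical backgrounds).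
HONEST SCOPE.  Linear algebra over landed letters + `HasDerivAt.deriv`; NO estimate of [5]∕[B11] proved; the (84) row IS the analytic content ((26)–(31) + (74)–(81) at T³, L);
not a proof of any stub; nothing continuum ∕ OS ∕ mass-gap ∕ Clay.

References: T. Bałaban, CMP **102** (1985) 277–309 [Balaban1985Variational] ((82)–(84) p.290, (93) p.291, (99)–(103) p.293, (110)–(111) p.294, (79) p.290);
CMP **99** (1985) 389–434 [Balaban1985BackgroundPropagators] ((3.8) p.392, (3.21) p.394, (3.26) p.395, (3.126) p.420, (3.127)–(3.128) p.421, (3.147) p.425, (3.153) p.426).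
-/

set_option autoImplicit false

noncomputable section

open scoped InnerProductSpace ComplexConjugate Matrix.Norms.L2Operator

namespace Summit.QuantumFields.YangMills.Theorems.Prop7Crit93OfEq111

open Literature.MathematicalPhysics.QuantumFieldTheory.Balaban1983to89
open Literature.MathematicalPhysics.QuantumFieldTheory.Balaban1983to89.T3ContinuumYM3Torus
open B9SectCLatticeCarrier (Bond)
open B9Eq311L2Pairing (WL2)
open B11Eq115Space (NegSize Space115 JetSup NegSup)
open B11Eq111FrakG (nabla115)
open B11Eq103H1Complex (SiteL2K BondL2K funEquiv)
open Summit.QuantumFields.YangMills.Theorems.Prop7SectET3Transport (periodsT3 bondEquiv bgOfCfg)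
open Summit.QuantumFields.YangMills.Theorems.Prop7SectET3HilbertLetters (W₂ frobEquiv toL2 toL2B QL2 DL2 DstarL2 QL2_toL2 adjoint_DL2)
open Summit.QuantumFields.YangMills.Theorems.Prop7SectET3GaugeProjector (NS RS RS_isSymmetric)
open Summit.QuantumFields.YangMills.Theorems.Prop7SectET3CurvedPropagators
open Summit.QuantumFields.YangMills.Theorems.Prop7SectET3DeltaPi
open Summit.QuantumFields.YangMills.Theorems.Prop7SectET3DeltaOne (DeltaOne DeltaOne_kills_NS inner_DL2_DeltaOne_eq_zero)
open Summit.QuantumFields.YangMills.Theorems.Prop7SymAvgTwSym (QTwS)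
open Summit.QuantumFields.YangMills.Theorems.Prop7SPrint (IsLandauPrintS isLandauPrintS_iff_RS)
open Summit.QuantumFields.YangMills.Theorems.Prop7HessRowOfEq111 (slot_sol_eq toL2_iota_eq111)

variable {F : T3Family} {n K : ℕ} {h : n ≤ K} {c₀ cB a : ℝ} [Fact (0 < c₀)] [Fact (0 < cB)]
  {Δx : GaugeField (F.P K) 0 (Matrix.specialUnitaryGroup (Fin 2) ℂ) → (BondL2K ℂ 3 (periodsT3 F K) c₀ W₂ →ₗ[ℂ] BondL2K ℂ 3 (periodsT3 F K) c₀ W₂)}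

/-! ## §1 The first-order Euler–Lagrange identity of the (111)-solution on the slice, Hilbert level -/

/-- ★★ **(99) FROM (111), GENERIC SLOT**: on the class `PosOnto` with the two Landau guards of the slot, for `Y = −𝔊x + Hb` and every `δ̂` with `Q_kδ̂ = 0`, `R_S(D*δ̂) = 0`:
`⟪x + Δx(U₀)Y, δ̂⟫ = 0` — the `range Q_k†` terms and the Landau multiplier `D(R_S(D*(Gx)))` of ✓`slot_sol_eq` are orthogonal to the slice (83).
[cite: Balaban1985Variational, (99) p.293, (102)–(103) p.293, (110)–(111) p.294; Balaban1985BackgroundPropagators, (3.8) p.392, (3.21) p.394, (3.26) p.395, (3.153) p.426] -/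
theorem inner_firstOrder_sol_eq_zero {U₀ : GaugeField (F.P K) 0 (Matrix.specialUnitaryGroup (Fin 2) ℂ)} (hp : PosOnto F n K h c₀ cB a Δx U₀)
    (hΔ : ∀ l ∈ NS F n K h c₀ cB U₀, Δx U₀ (DL2 F n K c₀ U₀ l) = 0) (hΔ' : ∀ l ∈ NS F n K h c₀ cB U₀, ∀ w, ⟪DL2 F n K c₀ U₀ l, Δx U₀ w⟫_ℂ = 0)
    (x : BondL2K ℂ 3 (periodsT3 F K) c₀ W₂) (b : WL2 ℂ (fun _ : PBond (F.P n) 0 => cB) W₂)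
    {δ : BondL2K ℂ 3 (periodsT3 F K) c₀ W₂} (hδQ : Qk F n K h c₀ cB U₀ δ = 0) (hδL : RS F n K h c₀ cB U₀ (DstarL2 F n K c₀ U₀ δ) = 0) :
    ⟪x + Δx U₀ (-(frakGT F n K h c₀ cB a Δx U₀ x) + HT F n K h c₀ cB a Δx U₀ b), δ⟫_ℂ = 0 := by
  rw [slot_sol_eq hp hΔ hΔ' x b]
  have hQ : ∀ z, ⟪LinearMap.adjoint (Qk F n K h c₀ cB U₀) z, δ⟫_ℂ = 0 := fun z => by
    rw [LinearMap.adjoint_inner_left, hδQ, inner_zero_right]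
  have hD : ∀ w, ⟪DL2 F n K c₀ U₀ (RS F n K h c₀ cB U₀ w), δ⟫_ℂ = 0 := fun w => by
    rw [← LinearMap.adjoint_inner_right, adjoint_DL2, RS_isSymmetric U₀, hδL, inner_zero_right]
  simp only [inner_add_left, inner_sub_left, inner_neg_left, hQ, hD]
  ring

/-- ★★ **(99) FROM (111) AT THE SLOT OF RECORD `Δ_π`**: the two Landau guards come from `PosPrime` (✓`DeltaPiSlot_kills_NS`, ✓`inner_DL2_DeltaPi_eq_zero`).
[cite: Balaban1985Variational, (99) p.293, (111) p.294; Balaban1985BackgroundPropagators, (3.119) p.419, (3.124) p.420] -/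
theorem inner_firstOrder_sol_eq_zero_pi {U₀ : GaugeField (F.P K) 0 (Matrix.specialUnitaryGroup (Fin 2) ℂ)}
    (hp : PosOnto F n K h c₀ cB a (DeltaPiSlot F n K h c₀ cB a) U₀) (hq : PosPrime F n K h c₀ cB a U₀)
    (x : BondL2K ℂ 3 (periodsT3 F K) c₀ W₂) (b : WL2 ℂ (fun _ : PBond (F.P n) 0 => cB) W₂)
    {δ : BondL2K ℂ 3 (periodsT3 F K) c₀ W₂} (hδQ : Qk F n K h c₀ cB U₀ δ = 0) (hδL : RS F n K h c₀ cB U₀ (DstarL2 F n K c₀ U₀ δ) = 0) :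
    ⟪x + DeltaPiSlot F n K h c₀ cB a U₀ (-(frakGT F n K h c₀ cB a (DeltaPiSlot F n K h c₀ cB a) U₀ x) + HT F n K h c₀ cB a (DeltaPiSlot F n K h c₀ cB a) U₀ b), δ⟫_ℂ = 0 :=
  inner_firstOrder_sol_eq_zero hp (DeltaPiSlot_kills_NS hq) (inner_DL2_DeltaPi_eq_zero hq) x b hδQ hδL

omit [Fact (0 < c₀)] [Fact (0 < cB)] in
/-- **THE SLICE DICTIONARY, `Q`-HALF**: `QTwS U₀ δ = 0 ⟹ Q_k(toL2 δ) = 0` (`Q_k = η • QL2`, ✓`QL2_toL2`). [cite: Balaban1985Variational, (83) p.290, (44)–(45) p.285] -/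
theorem Qk_toL2_eq_zero_of_QTwS (U₀ : GaugeField (F.P K) 0 (Matrix.specialUnitaryGroup (Fin 2) ℂ)) {δ : PBond (F.P K) 0 → Matrix (Fin 2) (Fin 2) ℂ}
    (hδ : QTwS F n K h U₀ δ = 0) : Qk F n K h c₀ cB U₀ (toL2 F K c₀ δ) = 0 := by
  simp only [Qk, LinearMap.smul_apply, QL2_toL2, hδ, map_zero, smul_zero]

omit [Fact (0 < cB)] in
/-- **THE SLICE DICTIONARY, LANDAU HALF**: `IsLandauPrintS c₀ cB U₀ δ ⟹ R_S(D*(toL2 δ)) = 0` (✓`isLandauPrintS_iff_RS`). [cite: Balaban1985Variational, (83) p.290, (21) p.281] -/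
theorem RS_DstarL2_toL2_eq_zero_of_landau (U₀ : GaugeField (F.P K) 0 (Matrix.specialUnitaryGroup (Fin 2) ℂ)) {δ : PBond (F.P K) 0 → Matrix (Fin 2) (Fin 2) ℂ}
    (hδ : IsLandauPrintS F n K h c₀ cB U₀ δ) : RS F n K h c₀ cB U₀ (DstarL2 F n K c₀ U₀ (toL2 F K c₀ δ)) = 0 :=
  (isLandauPrintS_iff_RS U₀ δ).mp hδ

/-! ## §2 The door: `hCrit93′` from (111) + the displayed (84)-row -/

omit [Fact (0 < cB)] in
/-- **CALCULUS SHELL**: if `⟪v, δ̂⟫ = 0` and a real function `f` has derivative `re(κ·⟪δ̂, v⟫)` at `0`, then `deriv f 0 = 0`. [folklore] -/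
theorem deriv_eq_zero_of_hasDerivAt_re_inner {f : ℝ → ℝ} {κ : ℂ} {v δ : BondL2K ℂ 3 (periodsT3 F K) c₀ W₂} (hv : ⟪v, δ⟫_ℂ = 0)
    (hf : HasDerivAt f (RCLike.re (κ * ⟪δ, v⟫_ℂ)) 0) : deriv f 0 = 0 := by
  rw [hf.deriv, ← inner_conj_symm, hv, map_zero, mul_zero, map_zero]

/-- ★★★ **`hCrit93′` FROM (111) + (84), IN THE EX KNIT'S LETTERS AT THE MEMBER, GENERIC SLOT.**  From the knit's (111) text `A₁ + 𝒢f J + 𝒢f W = 0` (`𝒢f := frakGfR … Δx U₀`,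
`W` standing for `Wf(A₁ + H₁fB̃)`), a slice direction `δ` (`QTwS U₀ δ = 0`, `IsLandauPrintS c₀ cB U₀ δ`), and the DISPLAYED (84)-row for a real function `f` — «`f` has derivative
`re(κ·⟪toL2 δ, Ĵ + Ŵ + Δx(U₀)(toL2 A′♭)⟫)` at `0`», `Ĵ + Ŵ := funEquiv⁻¹(NegSup.equiv J + NegSup.equiv W)`, `A′♭ := ι(A₁) + ι(H₁fB̃)` the knit's bond field, `κ : ℂ` free — conclude
`deriv f 0 = 0`.  The knit takes `f :=` the chart ray of `hCrit93′`. [cite: Balaban1985Variational, (84) p.290, (93) p.291, (99) p.293, (111) p.294] -/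
theorem deriv_eq_zero_of_eq111_of_h84 [Fact (0 < (F.L : ℝ))] [Fact (0 < ((F.L : ℝ)⁻¹) ^ (K - n))]
    {U₀ : GaugeField (F.P K) 0 (Matrix.specialUnitaryGroup (Fin 2) ℂ)} (hp : PosOnto F n K h c₀ cB a Δx U₀)
    (hΔ : ∀ l ∈ NS F n K h c₀ cB U₀, Δx U₀ (DL2 F n K c₀ U₀ l) = 0) (hΔ' : ∀ l ∈ NS F n K h c₀ cB U₀, ∀ w, ⟪DL2 F n K c₀ U₀ l, Δx U₀ w⟫_ℂ = 0)
    (A₁ : Space115 (F.L : ℝ) (((F.L : ℝ)⁻¹) ^ (K - n)) (fun _ : Bond 3 (periodsT3 F K) => K - n) (fun _ : Bond 3 (periodsT3 F K) × Fin 3 => K - n)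
      (nabla115 (((F.L : ℝ)⁻¹) ^ (K - n)) (bgOfCfg F K U₀)))
    (J W : NegSize (F.L : ℝ) (((F.L : ℝ)⁻¹) ^ (K - n)) (fun _ : Bond 3 (periodsT3 F K) => K - n) 3 (Matrix (Fin 2) (Fin 2) ℂ))
    (B : PBond (F.P n) 0 → Matrix (Fin 2) (Fin 2) ℂ)
    (heq : A₁ + frakGfR F n K h c₀ cB a Δx U₀ J + frakGfR F n K h c₀ cB a Δx U₀ W = 0)
    {δ : PBond (F.P K) 0 → Matrix (Fin 2) (Fin 2) ℂ} (hδQ : QTwS F n K h U₀ δ = 0) (hδL : IsLandauPrintS F n K h c₀ cB U₀ δ)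
    {f : ℝ → ℝ} {κ : ℂ}
    (h84 : HasDerivAt f (RCLike.re (κ * ⟪toL2 F K c₀ δ,
        (funEquiv frobEquiv (fun _ : Bond 3 (periodsT3 F K) => c₀)).symm (NegSup.equiv _ _ J + NegSup.equiv _ _ W)
          + Δx U₀ (toL2 F K c₀ ((fun b : PBond (F.P K) 0 => JetSup.equiv _ _ _ A₁ (bondEquiv F K b))
              + (fun b : PBond (F.P K) 0 => JetSup.equiv _ _ _ (H1f F n K h c₀ cB a Δx U₀ B) (bondEquiv F K b))))⟫_ℂ)) 0) :
    deriv f 0 = 0 := by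
  have hfun : ((fun b : PBond (F.P K) 0 => JetSup.equiv _ _ _ A₁ (bondEquiv F K b))
        + (fun b : PBond (F.P K) 0 => JetSup.equiv _ _ _ (H1f F n K h c₀ cB a Δx U₀ B) (bondEquiv F K b)))
      = fun b : PBond (F.P K) 0 => JetSup.equiv _ _ _ (A₁ + H1f F n K h c₀ cB a Δx U₀ B) (bondEquiv F K b) := by
    funext b
    rfl
  rw [hfun, toL2_iota_eq111 U₀ A₁ J W B heq] at h84
  exact deriv_eq_zero_of_hasDerivAt_re_inner
    (inner_firstOrder_sol_eq_zero hp hΔ hΔ' _ _ (Qk_toL2_eq_zero_of_QTwS U₀ hδQ) (RS_DstarL2_toL2_eq_zero_of_landau U₀ hδL)) h84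

/-- ★★★ **`hCrit93′` FROM (111) + (84) AT THE SLOT OF RECORD `Δ_π`** — the same with the letters of S9 (`frakGfR∕H1f … (DeltaPiSlot …) U₀`) from S9's one class row
`hN06 : PosOnto … (DeltaPiSlot …) U₀ ∧ PosPrime … U₀`. [cite: Balaban1985Variational, (84) p.290, (93) p.291, (111) p.294; Balaban1985BackgroundPropagators, Thm 3.11 p.418] -/
theorem deriv_eq_zero_of_eq111_of_h84_pi [Fact (0 < (F.L : ℝ))] [Fact (0 < ((F.L : ℝ)⁻¹) ^ (K - n))]
    {U₀ : GaugeField (F.P K) 0 (Matrix.specialUnitaryGroup (Fin 2) ℂ)}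
    (hN06 : PosOnto F n K h c₀ cB a (DeltaPiSlot F n K h c₀ cB a) U₀ ∧ PosPrime F n K h c₀ cB a U₀)
    (A₁ : Space115 (F.L : ℝ) (((F.L : ℝ)⁻¹) ^ (K - n)) (fun _ : Bond 3 (periodsT3 F K) => K - n) (fun _ : Bond 3 (periodsT3 F K) × Fin 3 => K - n)
      (nabla115 (((F.L : ℝ)⁻¹) ^ (K - n)) (bgOfCfg F K U₀)))
    (J W : NegSize (F.L : ℝ) (((F.L : ℝ)⁻¹) ^ (K - n)) (fun _ : Bond 3 (periodsT3 F K) => K - n) 3 (Matrix (Fin 2) (Fin 2) ℂ))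
    (B : PBond (F.P n) 0 → Matrix (Fin 2) (Fin 2) ℂ)
    (heq : A₁ + frakGfR F n K h c₀ cB a (DeltaPiSlot F n K h c₀ cB a) U₀ J + frakGfR F n K h c₀ cB a (DeltaPiSlot F n K h c₀ cB a) U₀ W = 0)
    {δ : PBond (F.P K) 0 → Matrix (Fin 2) (Fin 2) ℂ} (hδQ : QTwS F n K h U₀ δ = 0) (hδL : IsLandauPrintS F n K h c₀ cB U₀ δ)
    {f : ℝ → ℝ} {κ : ℂ}
    (h84 : HasDerivAt f (RCLike.re (κ * ⟪toL2 F K c₀ δ,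
        (funEquiv frobEquiv (fun _ : Bond 3 (periodsT3 F K) => c₀)).symm (NegSup.equiv _ _ J + NegSup.equiv _ _ W)
          + DeltaPiSlot F n K h c₀ cB a U₀ (toL2 F K c₀ ((fun b : PBond (F.P K) 0 => JetSup.equiv _ _ _ A₁ (bondEquiv F K b))
              + (fun b : PBond (F.P K) 0 => JetSup.equiv _ _ _ (H1f F n K h c₀ cB a (DeltaPiSlot F n K h c₀ cB a) U₀ B) (bondEquiv F K b))))⟫_ℂ)) 0) :
    deriv f 0 = 0 :=
  deriv_eq_zero_of_eq111_of_h84 hN06.1 (DeltaPiSlot_kills_NS hN06.2) (inner_DL2_DeltaPi_eq_zero hN06.2) A₁ J W B heq hδQ hδL h84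

/-- ★★★ **`hCrit93′` FROM (111) + (84) AT PRINT'S SLOT `Δ₁ = Pᵀ(Δ^η + T_J)P`** (✓`DeltaOne … TJ`, any J-term `T_J`; the Δ₁ of record is `TJ := TJSlot`, ✓`DeltaOneJ`): the letters
`frakGfR∕H1f … (DeltaOne … TJ) U₀` (= ✓`frakGfOne`∕`H1fOne` up to `iota`), from the class row `PosOnto … (DeltaOne … TJ) U₀ ∧ PosPrime … U₀` — «We take the operators H₁, 𝔓 defined by
the operator Δ₁» (p. 293). [cite: Balaban1985Variational, (84) p.290, (93) p.291, (99)–(100) p.293, (110)–(111) p.294; Balaban1985BackgroundPropagators, (3.127)–(3.128) p.421] -/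
theorem deriv_eq_zero_of_eq111_of_h84_one [Fact (0 < (F.L : ℝ))] [Fact (0 < ((F.L : ℝ)⁻¹) ^ (K - n))]
    {TJ : GaugeField (F.P K) 0 (Matrix.specialUnitaryGroup (Fin 2) ℂ) → (BondL2K ℂ 3 (periodsT3 F K) c₀ W₂ →ₗ[ℂ] BondL2K ℂ 3 (periodsT3 F K) c₀ W₂)}
    {U₀ : GaugeField (F.P K) 0 (Matrix.specialUnitaryGroup (Fin 2) ℂ)}
    (hN06 : PosOnto F n K h c₀ cB a (DeltaOne F n K h c₀ cB a TJ) U₀ ∧ PosPrime F n K h c₀ cB a U₀)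
    (A₁ : Space115 (F.L : ℝ) (((F.L : ℝ)⁻¹) ^ (K - n)) (fun _ : Bond 3 (periodsT3 F K) => K - n) (fun _ : Bond 3 (periodsT3 F K) × Fin 3 => K - n)
      (nabla115 (((F.L : ℝ)⁻¹) ^ (K - n)) (bgOfCfg F K U₀)))
    (J W : NegSize (F.L : ℝ) (((F.L : ℝ)⁻¹) ^ (K - n)) (fun _ : Bond 3 (periodsT3 F K) => K - n) 3 (Matrix (Fin 2) (Fin 2) ℂ))
    (B : PBond (F.P n) 0 → Matrix (Fin 2) (Fin 2) ℂ)
    (heq : A₁ + frakGfR F n K h c₀ cB a (DeltaOne F n K h c₀ cB a TJ) U₀ J + frakGfR F n K h c₀ cB a (DeltaOne F n K h c₀ cB a TJ) U₀ W = 0)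
    {δ : PBond (F.P K) 0 → Matrix (Fin 2) (Fin 2) ℂ} (hδQ : QTwS F n K h U₀ δ = 0) (hδL : IsLandauPrintS F n K h c₀ cB U₀ δ)
    {f : ℝ → ℝ} {κ : ℂ}
    (h84 : HasDerivAt f (RCLike.re (κ * ⟪toL2 F K c₀ δ,
        (funEquiv frobEquiv (fun _ : Bond 3 (periodsT3 F K) => c₀)).symm (NegSup.equiv _ _ J + NegSup.equiv _ _ W)
          + DeltaOne F n K h c₀ cB a TJ U₀ (toL2 F K c₀ ((fun b : PBond (F.P K) 0 => JetSup.equiv _ _ _ A₁ (bondEquiv F K b))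
              + (fun b : PBond (F.P K) 0 => JetSup.equiv _ _ _ (H1f F n K h c₀ cB a (DeltaOne F n K h c₀ cB a TJ) U₀ B) (bondEquiv F K b))))⟫_ℂ)) 0) :
    deriv f 0 = 0 :=
  deriv_eq_zero_of_eq111_of_h84 hN06.1 (DeltaOne_kills_NS hN06.2) (inner_DL2_DeltaOne_eq_zero hN06.2) A₁ J W B heq hδQ hδL h84

/-! ## §3 The door in (27)-PAIRING currency: `hCrit93′` from (111) + the lattice (84) row (the conclusion shape of lit `B11Eq81ExpansionZpow.hasDerivAt_actionZ_chartRay_real`) -/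

section PairingCurrency

open B11Eq90Transpose (pair27 pair27_eq_sum)
open B11Eq90V0primeCurrent (flat115 flat115_apply)
open B9Eq3119DeltaPiCarrier (currentCLM equiv_currentCLM)
open B9Eq311L2Pairing (WL2)
open B11Eq103H1Complex (funEquiv_symm_apply)
open Summit.QuantumFields.YangMills.Theorems.Prop7SectET3HilbertLetters (toL2_apply toL2_symm_apply inner_toL2)

variable [Fact (0 < (F.L : ℝ))] [Fact (0 < ((F.L : ℝ)⁻¹) ^ (K - n))]

omit [Fact (0 < c₀)] [Fact (0 < cB)] [Fact (0 < (F.L : ℝ))] [Fact (0 < ((F.L : ℝ)⁻¹) ^ (K - n))] in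
/-- `funEquiv⁻¹ g = toL2 (g ∘ bondEquiv)` — the (−3)-carrier's `L²` reading is `toL2` of the route-side function. [cite: Balaban1985BackgroundPropagators, (3.11) p.392] -/
theorem funEquiv_symm_eq_toL2' (g : Bond 3 (periodsT3 F K) → Matrix (Fin 2) (Fin 2) ℂ) :
    (funEquiv frobEquiv (fun _ : Bond 3 (periodsT3 F K) => c₀)).symm g = toL2 F K c₀ (fun b : PBond (F.P K) 0 => g (bondEquiv F K b)) := by
  apply (WL2.equiv ℂ (fun _ : Bond 3 (periodsT3 F K) => c₀) W₂).injective
  funext p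
  rw [funEquiv_symm_apply, toL2_apply, Equiv.apply_symm_apply]

omit [Fact (0 < cB)] [Fact (0 < (F.L : ℝ))] [Fact (0 < ((F.L : ℝ)⁻¹) ^ (K - n))] in
/-- **(27) IN `L²` LETTERS**: `pair27 τ₂ K g = η³·c₀⁻¹·⟪toL2 (g♭)ᴴ, toL2 K♭⟫` (`τ₂ = tr`, `d = 3`, route-side readings `·♭ := · ∘ bondEquiv`).
[cite: Balaban1985Variational, (27) p.282; Balaban1985BackgroundPropagators, (3.11) p.392] -/
theorem pair27_eq_inner_toL2 (Kn : NegSize (F.L : ℝ) (((F.L : ℝ)⁻¹) ^ (K - n)) (fun _ : Bond 3 (periodsT3 F K) => K - n) 3 (Matrix (Fin 2) (Fin 2) ℂ))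
    (g : Bond 3 (periodsT3 F K) → Matrix (Fin 2) (Fin 2) ℂ) :
    pair27 (LinearMap.toContinuousLinearMap (Matrix.traceLinearMap (Fin 2) ℂ ℂ)) Kn g
      = ((((F.L : ℝ)⁻¹) ^ (K - n) : ℝ) : ℂ) ^ 3 * ((c₀ : ℂ)⁻¹ *
          ⟪toL2 F K c₀ (star (fun b : PBond (F.P K) 0 => g (bondEquiv F K b))), toL2 F K c₀ (fun b : PBond (F.P K) 0 => NegSup.equiv _ _ Kn (bondEquiv F K b))⟫_ℂ) := by
  have hc : (c₀ : ℂ) ≠ 0 := Complex.ofReal_ne_zero.2 (Fact.out : 0 < c₀).ne'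
  rw [pair27_eq_sum, inner_toL2, ← mul_assoc (c₀ : ℂ)⁻¹, inv_mul_cancel₀ hc, one_mul, ← (bondEquiv F K).sum_comp]
  congr 1
  refine Finset.sum_congr rfl fun b _ => ?_
  rw [LinearMap.coe_toContinuousLinearMap', Matrix.traceLinearMap_apply, Pi.star_apply, Matrix.star_eq_conjTranspose, Matrix.conjTranspose_conjTranspose,
    Matrix.trace_mul_comm]

omit [Fact (0 < c₀)] [Fact (0 < cB)] in
/-- **A CURRENT READ FROM AN `L²` OPERATOR, IN `L²` LETTERS**: `toL2 ((currentCLM … T Y)♭) = T (toL2 (ιY))`, `ιY := (JetSup.equiv Y) ∘ bondEquiv`.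
[cite: Balaban1985Variational, (27) p.282, (80) p.290] -/
theorem toL2_currentCLM (U₀ : GaugeField (F.P K) 0 (Matrix.specialUnitaryGroup (Fin 2) ℂ)) (T : BondL2K ℂ 3 (periodsT3 F K) c₀ W₂ →ₗ[ℂ] BondL2K ℂ 3 (periodsT3 F K) c₀ W₂)
    (Y : Space115 (F.L : ℝ) (((F.L : ℝ)⁻¹) ^ (K - n)) (fun _ : Bond 3 (periodsT3 F K) => K - n) (fun _ : Bond 3 (periodsT3 F K) × Fin 3 => K - n)
      (nabla115 (((F.L : ℝ)⁻¹) ^ (K - n)) (bgOfCfg F K U₀))) :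
    toL2 F K c₀ (fun b : PBond (F.P K) 0 => NegSup.equiv _ _
        (currentCLM frobEquiv (fun _ : Bond 3 (periodsT3 F K) × Fin 3 => K - n) (nabla115 (((F.L : ℝ)⁻¹) ^ (K - n)) (bgOfCfg F K U₀)) T Y) (bondEquiv F K b))
      = T (toL2 F K c₀ (fun b : PBond (F.P K) 0 => JetSup.equiv _ _ _ Y (bondEquiv F K b))) := by
  have h : (fun b : PBond (F.P K) 0 => NegSup.equiv _ _
        (currentCLM frobEquiv (fun _ : Bond 3 (periodsT3 F K) × Fin 3 => K - n) (nabla115 (((F.L : ℝ)⁻¹) ^ (K - n)) (bgOfCfg F K U₀)) T Y) (bondEquiv F K b))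
      = (toL2 F K c₀).symm (T (toL2 F K c₀ (fun b : PBond (F.P K) 0 => JetSup.equiv _ _ _ Y (bondEquiv F K b)))) := by
    funext b
    rw [equiv_currentCLM, flat115_apply, funEquiv_symm_eq_toL2', toL2_symm_apply]
  rw [h, LinearEquiv.apply_symm_apply]

/-- ★★ **THE (84) ROW'S THREE PAIRINGS IN `L²` LETTERS**: for (−3)-data `J W`, an `L²` operator `T` read as a current, and (115)-fields `Y δ′`:
`⟨δ′, J⟩ + ⟨δ′, T̂Y⟩ + ⟨δ′, W⟩ = η³c₀⁻¹ · ⟪toL2 (ιδ′)ᴴ, (Ĵ + Ŵ) + T(toL2 ιY)⟫` — the bridge from lit `hasDerivAt_actionZ_chartRay_real`'s conclusion to §2's `h84`.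
[cite: Balaban1985Variational, (84) p.290, (27) p.282] -/
theorem sum_pair27_eq_inner (U₀ : GaugeField (F.P K) 0 (Matrix.specialUnitaryGroup (Fin 2) ℂ)) (T : BondL2K ℂ 3 (periodsT3 F K) c₀ W₂ →ₗ[ℂ] BondL2K ℂ 3 (periodsT3 F K) c₀ W₂)
    (J W : NegSize (F.L : ℝ) (((F.L : ℝ)⁻¹) ^ (K - n)) (fun _ : Bond 3 (periodsT3 F K) => K - n) 3 (Matrix (Fin 2) (Fin 2) ℂ))
    (Y δ' : Space115 (F.L : ℝ) (((F.L : ℝ)⁻¹) ^ (K - n)) (fun _ : Bond 3 (periodsT3 F K) => K - n) (fun _ : Bond 3 (periodsT3 F K) × Fin 3 => K - n)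
      (nabla115 (((F.L : ℝ)⁻¹) ^ (K - n)) (bgOfCfg F K U₀))) :
    pair27 (LinearMap.toContinuousLinearMap (Matrix.traceLinearMap (Fin 2) ℂ ℂ)) J (flat115 δ')
      + pair27 (LinearMap.toContinuousLinearMap (Matrix.traceLinearMap (Fin 2) ℂ ℂ))
          (currentCLM frobEquiv (fun _ : Bond 3 (periodsT3 F K) × Fin 3 => K - n) (nabla115 (((F.L : ℝ)⁻¹) ^ (K - n)) (bgOfCfg F K U₀)) T Y) (flat115 δ')
      + pair27 (LinearMap.toContinuousLinearMap (Matrix.traceLinearMap (Fin 2) ℂ ℂ)) W (flat115 δ')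
      = ((((F.L : ℝ)⁻¹) ^ (K - n) : ℝ) : ℂ) ^ 3 * ((c₀ : ℂ)⁻¹ *
          ⟪toL2 F K c₀ (star (fun b : PBond (F.P K) 0 => JetSup.equiv _ _ _ δ' (bondEquiv F K b))),
            (funEquiv frobEquiv (fun _ : Bond 3 (periodsT3 F K) => c₀)).symm (NegSup.equiv _ _ J + NegSup.equiv _ _ W)
              + T (toL2 F K c₀ (fun b : PBond (F.P K) 0 => JetSup.equiv _ _ _ Y (bondEquiv F K b)))⟫_ℂ) := by
  rw [pair27_eq_inner_toL2 (c₀ := c₀), pair27_eq_inner_toL2 (c₀ := c₀), pair27_eq_inner_toL2 (c₀ := c₀), flat115_apply, toL2_currentCLM,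
    funEquiv_symm_eq_toL2']
  have hJW : (fun b : PBond (F.P K) 0 => (NegSup.equiv _ _ J + NegSup.equiv _ _ W) (bondEquiv F K b))
      = (fun b : PBond (F.P K) 0 => NegSup.equiv _ _ J (bondEquiv F K b)) + (fun b : PBond (F.P K) 0 => NegSup.equiv _ _ W (bondEquiv F K b)) := rfl
  rw [hJW, map_add, inner_add_right, inner_add_right]
  ring

/-- ★★★ **`hCrit93′` FROM (111) + THE LATTICE (84) ROW, GENERIC SLOT** — §2's door with `h84` stated in the (27)-pairing currency that lit
`B11Eq81ExpansionZpow.hasDerivAt_actionZ_chartRay_real` concludes: «`f` has derivative `re(κ · (⟨δ′, J⟩ + ⟨δ′, Δ̂ₓA′⟩ + ⟨δ′, W⟩))` at `0`» with `Δ̂ₓ := currentCLM … (Δx U₀)` (the slot READ as a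
current), `A′ := A₁ + H₁f B̃`, and the direction `δ′` whose route reading `ιδ′` is HERMITIAN (A-units) and lies on the slice (`QTwS U₀ (ιδ′) = 0`, `IsLandauPrintS … (ιδ′)`).
[cite: Balaban1985Variational, (84) p.290, (93) p.291, (99) p.293, (111) p.294] -/
theorem deriv_eq_zero_of_eq111_of_h84_pair27
    {U₀ : GaugeField (F.P K) 0 (Matrix.specialUnitaryGroup (Fin 2) ℂ)} (hp : PosOnto F n K h c₀ cB a Δx U₀)
    (hΔ : ∀ l ∈ NS F n K h c₀ cB U₀, Δx U₀ (DL2 F n K c₀ U₀ l) = 0) (hΔ' : ∀ l ∈ NS F n K h c₀ cB U₀, ∀ w, ⟪DL2 F n K c₀ U₀ l, Δx U₀ w⟫_ℂ = 0)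
    (A₁ : Space115 (F.L : ℝ) (((F.L : ℝ)⁻¹) ^ (K - n)) (fun _ : Bond 3 (periodsT3 F K) => K - n) (fun _ : Bond 3 (periodsT3 F K) × Fin 3 => K - n)
      (nabla115 (((F.L : ℝ)⁻¹) ^ (K - n)) (bgOfCfg F K U₀)))
    (J W : NegSize (F.L : ℝ) (((F.L : ℝ)⁻¹) ^ (K - n)) (fun _ : Bond 3 (periodsT3 F K) => K - n) 3 (Matrix (Fin 2) (Fin 2) ℂ))
    (B : PBond (F.P n) 0 → Matrix (Fin 2) (Fin 2) ℂ)
    (heq : A₁ + frakGfR F n K h c₀ cB a Δx U₀ J + frakGfR F n K h c₀ cB a Δx U₀ W = 0)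
    {δ' : Space115 (F.L : ℝ) (((F.L : ℝ)⁻¹) ^ (K - n)) (fun _ : Bond 3 (periodsT3 F K) => K - n) (fun _ : Bond 3 (periodsT3 F K) × Fin 3 => K - n)
      (nabla115 (((F.L : ℝ)⁻¹) ^ (K - n)) (bgOfCfg F K U₀))}
    (hδR : ∀ b : PBond (F.P K) 0, star (JetSup.equiv _ _ _ δ' (bondEquiv F K b)) = JetSup.equiv _ _ _ δ' (bondEquiv F K b))
    (hδQ : QTwS F n K h U₀ (fun b : PBond (F.P K) 0 => JetSup.equiv _ _ _ δ' (bondEquiv F K b)) = 0)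
    (hδL : IsLandauPrintS F n K h c₀ cB U₀ (fun b : PBond (F.P K) 0 => JetSup.equiv _ _ _ δ' (bondEquiv F K b)))
    {f : ℝ → ℝ} {κ : ℂ}
    (h84 : HasDerivAt f (RCLike.re (κ * (pair27 (LinearMap.toContinuousLinearMap (Matrix.traceLinearMap (Fin 2) ℂ ℂ)) J (flat115 δ')
      + pair27 (LinearMap.toContinuousLinearMap (Matrix.traceLinearMap (Fin 2) ℂ ℂ))
          (currentCLM frobEquiv (fun _ : Bond 3 (periodsT3 F K) × Fin 3 => K - n) (nabla115 (((F.L : ℝ)⁻¹) ^ (K - n)) (bgOfCfg F K U₀)) (Δx U₀) (A₁ + H1f F n K h c₀ cB a Δx U₀ B)) (flat115 δ')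
      + pair27 (LinearMap.toContinuousLinearMap (Matrix.traceLinearMap (Fin 2) ℂ ℂ)) W (flat115 δ')))) 0) :
    deriv f 0 = 0 := by
  have hstar : star (fun b : PBond (F.P K) 0 => JetSup.equiv _ _ _ δ' (bondEquiv F K b)) = fun b : PBond (F.P K) 0 => JetSup.equiv _ _ _ δ' (bondEquiv F K b) :=
    funext fun b => hδR b
  rw [sum_pair27_eq_inner, hstar, ← mul_assoc, ← mul_assoc] at h84
  have hfun : ((fun b : PBond (F.P K) 0 => JetSup.equiv _ _ _ A₁ (bondEquiv F K b))
        + (fun b : PBond (F.P K) 0 => JetSup.equiv _ _ _ (H1f F n K h c₀ cB a Δx U₀ B) (bondEquiv F K b)))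
      = fun b : PBond (F.P K) 0 => JetSup.equiv _ _ _ (A₁ + H1f F n K h c₀ cB a Δx U₀ B) (bondEquiv F K b) := by
    funext b
    rfl
  rw [← hfun] at h84
  exact deriv_eq_zero_of_eq111_of_h84 hp hΔ hΔ' A₁ J W B heq hδQ hδL h84

end PairingCurrency

end Summit.QuantumFields.YangMills.Theorems.Prop7Crit93OfEq111

end
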